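import Summits.RiemannHypothesis.RiemannHypothesis.Theorems.HandoffLatticeUncertaintyPointwise
import Summits.RiemannHypothesis.RiemannHypothesis.Theorems.HandoffLatticeUncertaintyAux
import Literature.Analysis.FunctionSpaces.PlancherelL1L2
import HarnessLib

/-!
# THEOREM U0, part 4/4 — the lattice tail is bounded, the leakage diverges: (U-LATTICE) is degenerate

Handoff track (ROUTE 1′), prove-1 gen14, ATTEMPT-21; concludes `HandoffLatticeUncertainty`,
`…Pointwise`, `…Aux`. LEMMA 2 (`latticeTail_le`): the squared dilation sum of `F_η` is integrable on
`(0, 1/λ]` and `latticeTail λ F_η ≤ 6K² + 8` UNIFORMLY in `η` (the majorant `2K²(1 + 2/η)` on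
`(0, η)`, `2K² + 8η/u²` on `[η, 1]` integrates to `≤ 6K² + 8`). The witness is admissible: in
`L¹ ∩ L²`, `∫ F_η = 0` (`integral_F`), `‖F_η‖₁ ≤ 32` (`integral_norm_F_le`). LEMMA 3 (`leakage_ge`):
`leakage λ F_η ≥ log((1/2)/η) - 2048λ` by Plancherel on `L¹ ∩ L²` (tree
`Literature.Analysis.FunctionSpaces.integral_norm_sq_fourierIntegral_eq`), `|𝓕F| ≤ ‖F‖₁` on the
band `(-λ, λ)`, and `‖F_η(x)‖² = x⁻¹` on `(η, 1/2)`. ★ THEOREM U0 (`latticeUncertainty_degenerate`):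
for every `λ ≥ 1`, `ε > 0` there is an admissible `F` with `0 < leakage λ F` and
`latticeTail λ F ≤ ε · leakage λ F` — idea-1's (U-LATTICE-ℓ) «`ℓ·μ_min(λ) ≥ m₀ > 0`» (IDEAS-prolate
§127.2 (F-iv), §127.4 U1) is false as typed; the infimum is resolution-limited, not `λ`-limited
(ATTEMPT-21 §4–§5 for the repaired two-level object that idea-1's engine actually computes).
Nothing here bears on the truth of RH: a statement about the lattice sums of one explicit family of
time-limited functions.
-/

set_option linter.dupNamespace false

noncomputable section

open Complex MeasureTheory Set Filter Finset
open scoped Real FourierTransform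

namespace Summit.RiemannHypothesis.RiemannHypothesis.Theorems

namespace LatticeUncertainty


/-! ## LEMMA 2: the lattice tail of the witness is bounded uniformly in `η` -/

variable {ρ : ℂ}

/-- The square of the pointwise bound: a piecewise majorant `g` with
`‖θ(u)‖² ≤ g(u)` on `(0, 1]`. -/
theorem norm_sq_dilationSum_le (h0 : riemannZeta ρ = 0) (hre : ρ.re = 1 / 2) (him : ρ.im ≠ 0)
    {η lam u : ℝ} (hη : 0 < η) (hη4 : η ≤ 1 / 4) (hlam : 1 ≤ lam) (hu : 0 < u) (hu1 : u ≤ 1) :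
    ‖dilationSum lam (F ρ η) u‖ ^ 2
      ≤ if u < η then 2 * K ρ ^ 2 * (1 + 2 / η) else 2 * K ρ ^ 2 + 8 * η * u ^ (-2 : ℤ) := by
  have h := norm_dilationSum_le h0 hre him hη hη4 hlam hu hu1
  have hK := K_pos (ρ := ρ)
  obtain ⟨r1, r2⟩ := rpow_aux hη
  have hn : 0 ≤ ‖dilationSum lam (F ρ η) u‖ := norm_nonneg _
  split_ifs at h ⊢ with hcase
  · -- `(K(1+q))² ≤ 2K²(1+q²)`, `q² = 2/η`
    set q := (η / 2) ^ (-(1 / 2 : ℝ)) with hq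
    have hq0 : 0 ≤ q := by positivity
    calc ‖dilationSum lam (F ρ η) u‖ ^ 2 ≤ (K ρ * (1 + q)) ^ 2 := by
          exact pow_le_pow_left₀ hn h 2
      _ ≤ 2 * K ρ ^ 2 * (1 + q ^ 2) := by nlinarith [sq_nonneg (1 - q), sq_nonneg (K ρ)]
      _ = 2 * K ρ ^ 2 * (1 + 2 / η) := by rw [r1]
  · set p := η ^ (1 / 2 : ℝ) with hp
    have hp0 : 0 ≤ p := by positivity
    have hzpow : u ^ (-2 : ℤ) = (u ^ 2)⁻¹ := by simp [zpow_neg, zpow_ofNat]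
    calc ‖dilationSum lam (F ρ η) u‖ ^ 2 ≤ (K ρ + 2 * p / u) ^ 2 := by
          exact pow_le_pow_left₀ hn h 2
      _ ≤ 2 * K ρ ^ 2 + 2 * (2 * p / u) ^ 2 := by nlinarith [sq_nonneg (K ρ - 2 * p / u)]
      _ = 2 * K ρ ^ 2 + 8 * η * u ^ (-2 : ℤ) := by
          rw [hzpow, div_pow, mul_pow, r2]; ring

/-- **LEMMA 2.** For `0 < η ≤ 1/4` and `λ ≥ 1`: the squared dilation sum of `F_η` is integrable on
`(0, 1/λ]` and `latticeTail λ F_η ≤ 6K² + 8`, uniformly in `η`. -/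
theorem latticeTail_le (h0 : riemannZeta ρ = 0) (hre : ρ.re = 1 / 2) (him : ρ.im ≠ 0)
    {η lam : ℝ} (hη : 0 < η) (hη4 : η ≤ 1 / 4) (hlam : 1 ≤ lam) :
    IntegrableOn (fun u ↦ ‖dilationSum lam (F ρ η) u‖ ^ 2) (Set.Ioc 0 (1 / lam)) ∧
      latticeTail lam (F ρ η) ≤ 6 * K ρ ^ 2 + 8 := by
  have hK := K_pos (ρ := ρ)
  set θ2 : ℝ → ℝ := fun u ↦ ‖dilationSum lam (F ρ η) u‖ ^ 2 with hθ2
  set g : ℝ → ℝ := fun u ↦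
    if u < η then 2 * K ρ ^ 2 * (1 + 2 / η) else 2 * K ρ ^ 2 + 8 * η * u ^ (-2 : ℤ) with hg
  have hθm : Measurable θ2 :=
    ((measurable_dilationSum (measurable_F ρ η) lam).norm).pow_const 2
  have hgm : Measurable g := by
    refine Measurable.ite measurableSet_Iio measurable_const ?_
    exact measurable_const.add (measurable_const.mul (measurable_id.pow_const _))
  -- pointwise domination on `(0, 1]`
  have hdom : ∀ u ∈ Set.Ioc (0 : ℝ) 1, θ2 u ≤ g u := fun u hu ↦
    norm_sq_dilationSum_le h0 hre him hη hη4 hlam hu.1 hu.2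
  -- `g` is bounded on `(0,1]`
  set B : ℝ := 2 * K ρ ^ 2 * (1 + 2 / η) + (2 * K ρ ^ 2 + 8 * η * η ^ (-2 : ℤ)) with hB
  have hgB : ∀ u ∈ Set.Ioc (0 : ℝ) 1, g u ≤ B := by
    intro u hu
    simp only [hg]
    split_ifs with hc
    · have : 0 ≤ 2 * K ρ ^ 2 + 8 * η * η ^ (-2 : ℤ) := by positivity
      linarith
    · rw [not_lt] at hc
      have h1 : u ^ (-2 : ℤ) ≤ η ^ (-2 : ℤ) := by
        rw [show (-2 : ℤ) = -((2 : ℕ) : ℤ) by norm_num, zpow_neg, zpow_neg, zpow_natCast,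
          zpow_natCast]
        exact inv_anti₀ (by positivity) (pow_le_pow_left₀ hη.le hc 2)
      have : 0 ≤ 2 * K ρ ^ 2 * (1 + 2 / η) := by positivity
      nlinarith
  have hg0 : ∀ u ∈ Set.Ioc (0 : ℝ) 1, 0 ≤ g u := fun u hu ↦
    (sq_nonneg _).trans (hdom u hu)
  have hθB : ∀ u ∈ Set.Ioc (0 : ℝ) 1, ‖θ2 u‖ ≤ B := by
    intro u hu
    rw [Real.norm_eq_abs, abs_of_nonneg (sq_nonneg _)]
    exact (hdom u hu).trans (hgB u hu)
  have hIθ : IntegrableOn θ2 (Set.Ioc 0 1) :=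
    Measure.integrableOn_of_bounded (by simp) hθm.aestronglyMeasurable
      ((ae_restrict_iff' measurableSet_Ioc).2 (Eventually.of_forall hθB))
  have hIg : IntegrableOn g (Set.Ioc 0 1) :=
    Measure.integrableOn_of_bounded (by simp) hgm.aestronglyMeasurable
      ((ae_restrict_iff' measurableSet_Ioc).2 (Eventually.of_forall fun u hu ↦ by
        rw [Real.norm_eq_abs, abs_of_nonneg (hg0 u hu)]; exact hgB u hu))
  have hsub : Set.Ioc (0 : ℝ) (1 / lam) ⊆ Set.Ioc 0 1 :=
    Set.Ioc_subset_Ioc le_rfl (by rw [div_le_one (by linarith)]; exact hlam)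
  refine ⟨hIθ.mono_set hsub, ?_⟩
  -- `∫_{(0,1/λ]} θ² ≤ ∫_{(0,1]} θ² ≤ ∫_{(0,1]} g`
  have step1 : latticeTail lam (F ρ η) ≤ ∫ u in Set.Ioc (0 : ℝ) 1, θ2 u :=
    setIntegral_mono_set hIθ (Eventually.of_forall fun u ↦ sq_nonneg _)
      (Eventually.of_forall hsub)
  have step2 : ∫ u in Set.Ioc (0 : ℝ) 1, θ2 u ≤ ∫ u in Set.Ioc (0 : ℝ) 1, g u :=
    setIntegral_mono_on hIθ hIg measurableSet_Ioc hdom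
  -- `∫_{(0,1]} g = ∫_{(0,η)} g + ∫_{[η,1]} g`
  have hsplit : Set.Ioc (0 : ℝ) 1 = Set.Ioo 0 η ∪ Set.Icc η 1 :=
    (Set.Ioo_union_Icc_eq_Ioc hη (by linarith)).symm
  have hdisj : Disjoint (Set.Ioo (0 : ℝ) η) (Set.Icc η 1) := by
    rw [Set.disjoint_left]; intro u hu hu'; exact absurd hu'.1 (not_le.2 hu.2)
  have step3 : ∫ u in Set.Ioc (0 : ℝ) 1, g u
      = (∫ u in Set.Ioo (0 : ℝ) η, g u) + ∫ u in Set.Icc η 1, g u := by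
    rw [hsplit]
    exact setIntegral_union hdisj measurableSet_Icc
      (hIg.mono_set (by rw [hsplit]; exact Set.subset_union_left))
      (hIg.mono_set (by rw [hsplit]; exact Set.subset_union_right))
  -- first piece: the constant
  have piece1 : ∫ u in Set.Ioo (0 : ℝ) η, g u = η * (2 * K ρ ^ 2 * (1 + 2 / η)) := by
    have hEq : Set.EqOn g (fun _ ↦ 2 * K ρ ^ 2 * (1 + 2 / η)) (Set.Ioo 0 η) :=
      fun u hu ↦ by simp only [hg, if_pos hu.2]
    rw [setIntegral_congr_fun measurableSet_Ioo hEq,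
      setIntegral_const, Real.volume_real_Ioo_of_le hη.le, sub_zero, smul_eq_mul]
  -- second piece: `∫_η^1 (2K² + 8η u^{-2}) = 2K²(1-η) + 8η(η⁻¹ - 1)`
  have hI2 : IntervalIntegrable (fun u : ℝ ↦ 8 * η * u ^ (-2 : ℤ)) volume η 1 := by
    refine (continuousOn_const.mul (continuousOn_id.zpow₀ (-2) fun x hx ↦ Or.inl ?_)).intervalIntegrable
    rw [Set.uIcc_of_le (by linarith : η ≤ 1)] at hx
    exact (lt_of_lt_of_le hη hx.1).ne'
  have piece2 : ∫ u in Set.Icc η 1, g u = 2 * K ρ ^ 2 * (1 - η) + 8 * η * (η⁻¹ - 1) := by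
    have hEq : Set.EqOn g (fun u ↦ 2 * K ρ ^ 2 + 8 * η * u ^ (-2 : ℤ)) (Set.Icc η 1) :=
      fun u hu ↦ by simp only [hg, if_neg (not_lt.2 hu.1)]
    have hadd := intervalIntegral.integral_add (intervalIntegrable_const (c := 2 * K ρ ^ 2)
      (μ := volume) (a := η) (b := 1)) hI2
    rw [setIntegral_congr_fun measurableSet_Icc hEq, integral_Icc_eq_integral_Ioc,
      ← intervalIntegral.integral_of_le (by linarith : η ≤ 1), hadd,
      intervalIntegral.integral_const, intervalIntegral.integral_const_mul,
      integral_zpow_neg_two hη (by linarith), smul_eq_mul]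
    ring
  have total : ∫ u in Set.Ioc (0 : ℝ) 1, g u ≤ 6 * K ρ ^ 2 + 8 := by
    rw [step3, piece1, piece2]
    have e1 : η * (2 * K ρ ^ 2 * (1 + 2 / η)) = 2 * K ρ ^ 2 * η + 4 * K ρ ^ 2 := by
      field_simp; ring
    have e2 : 8 * η * (η⁻¹ - 1) = 8 - 8 * η := by field_simp
    rw [e1, e2]
    nlinarith
  exact step1.trans (step2.trans total)


/-! ## The witness is admissible -/

variable {ρ : ℂ}

/-- Bounds on the witness: `‖G_η(x)‖ ≤ 8 x^{-1/2}` on `[η, 1]`, `G_η = 0` off `[η, 1]`. -/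
theorem norm_G_le (hre : ρ.re = 1 / 2) {η : ℝ} (hη : 0 < η) (hη1 : η ≤ 1 / 2) (x : ℝ) :
    ‖G ρ η x‖ ≤ (Set.Icc η 1).indicator (fun x ↦ 8 * x ^ (-(1 / 2 : ℝ))) x := by
  by_cases hx : x ∈ Set.Icc η 1
  · rw [Set.indicator_of_mem hx]
    have hx0 : 0 < x := hη.trans_le hx.1
    have hκ := norm_kappa_le hre hη (by linarith)
    have hm1 : ‖mono ρ η 1 x‖ ≤ x ^ (-(1 / 2 : ℝ)) := by
      unfold mono; split_ifs
      · rw [Complex.norm_cpow_eq_rpow_re_of_pos hx0, neg_re, hre]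
      · rw [norm_zero]; positivity
    have hm2 : ‖mono ρ (1 / 2) 1 x‖ ≤ x ^ (-(1 / 2 : ℝ)) := by
      unfold mono; split_ifs
      · rw [Complex.norm_cpow_eq_rpow_re_of_pos hx0, neg_re, hre]
      · rw [norm_zero]; positivity
    calc ‖G ρ η x‖ ≤ ‖mono ρ η 1 x‖ + ‖kappa ρ η * mono ρ (1 / 2) 1 x‖ := norm_sub_le _ _
      _ ≤ x ^ (-(1 / 2 : ℝ)) + 7 * x ^ (-(1 / 2 : ℝ)) := by
          rw [norm_mul]; gcongr
      _ = 8 * x ^ (-(1 / 2 : ℝ)) := by ring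
  · rw [Set.indicator_of_notMem hx]
    simp only [Set.mem_Icc, not_and_or, not_le] at hx
    rcases hx with hx | hx
    · rw [G_of_lt hη1 hx, norm_zero]
    · rw [G_of_gt_one hx, norm_zero]

/-- Crude uniform bound `‖G_η(x)‖ ≤ 8 η^{-1/2}`. -/
theorem norm_G_le_const (hre : ρ.re = 1 / 2) {η : ℝ} (hη : 0 < η) (hη1 : η ≤ 1 / 2) (x : ℝ) :
    ‖G ρ η x‖ ≤ 8 * η ^ (-(1 / 2 : ℝ)) := by
  refine (norm_G_le hre hη hη1 x).trans ?_
  by_cases hx : x ∈ Set.Icc η 1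
  · rw [Set.indicator_of_mem hx]
    have h1 : x ^ (-(1 / 2 : ℝ)) ≤ η ^ (-(1 / 2 : ℝ)) :=
      Real.rpow_le_rpow_of_nonpos hη hx.1 (by norm_num)
    linarith
  · rw [Set.indicator_of_notMem hx]; positivity

/-- `G_η` vanishes off `[η, 1]`. -/
theorem G_eq_zero_of_notMem {η : ℝ} (hη1 : η ≤ 1 / 2) {x : ℝ} (hx : x ∉ Set.Icc η 1) :
    G ρ η x = 0 := by
  simp only [Set.mem_Icc, not_and_or, not_le] at hx
  rcases hx with hx | hx
  · exact G_of_lt hη1 hx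
  · exact G_of_gt_one hx

/-- `G_η` is integrable. -/
theorem integrable_G (hre : ρ.re = 1 / 2) {η : ℝ} (hη : 0 < η) (hη1 : η ≤ 1 / 2) :
    Integrable (G ρ η) :=
  integrable_of_bdd_of_support (measurable_G ρ η).aestronglyMeasurable
    (norm_G_le_const hre hη hη1) (fun _ hx ↦ G_eq_zero_of_notMem hη1 hx)

/-- `F_η ∈ L¹`. -/
theorem integrable_F (hre : ρ.re = 1 / 2) {η : ℝ} (hη : 0 < η) (hη1 : η ≤ 1 / 2) :
    Integrable (F ρ η) :=
  (integrable_G hre hη hη1).add ((integrable_G hre hη hη1).comp_neg)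

/-- `F_η ∈ L²`. -/
theorem memLp_F (hre : ρ.re = 1 / 2) {η : ℝ} (hη : 0 < η) (hη1 : η ≤ 1 / 2) :
    MemLp (F ρ η) 2 := by
  rw [memLp_two_iff_integrable_sq_norm (measurable_F ρ η).aestronglyMeasurable]
  have hsupp := support_F (ρ := ρ) hη (lam := 1) le_rfl
  refine integrable_of_bdd_of_support (((measurable_F ρ η).norm.pow_const 2).aestronglyMeasurable)
    (M := (8 * η ^ (-(1 / 2 : ℝ)) + 8 * η ^ (-(1 / 2 : ℝ))) ^ 2) (fun x ↦ ?_) (a := -1) (b := 1)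
    (fun x hx ↦ ?_)
  · rw [Real.norm_eq_abs, abs_of_nonneg (sq_nonneg _)]
    refine pow_le_pow_left₀ (norm_nonneg _) ?_ 2
    exact (norm_add_le _ _).trans (add_le_add (norm_G_le_const hre hη hη1 x)
      (norm_G_le_const hre hη hη1 (-x)))
  · have : F ρ η x = 0 := Function.notMem_support.1 fun h ↦ hx (hsupp h)
    simp [this]

/-- `∫ F_η = 0` (the choice of `κ_η`). -/
theorem integral_F (hre : ρ.re = 1 / 2) {η : ℝ} (hη : 0 < η) (hη1 : η ≤ 1 / 2) :
    ∫ x, F ρ η x = 0 := by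
  have hG := integrable_G hre hη hη1 (ρ := ρ)
  have h1 : ∫ x, F ρ η x = (∫ x, G ρ η x) + ∫ x, G ρ η (-x) := integral_add hG hG.comp_neg
  rw [h1, integral_neg_eq_self (G ρ η) volume]
  have hGint : ∫ x, G ρ η x = 0 := by
    have hm1 := (integrable_of_bdd_of_support (measurable_mono ρ η 1).aestronglyMeasurable
      (fun x ↦ norm_mono_le (b := 1) (x := x) hη hre) (fun x hx ↦ mono_of_not_mem (by simpa using hx)))
    have hm2 := (integrable_of_bdd_of_support (measurable_mono ρ (1 / 2) 1).aestronglyMeasurable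
      (fun x ↦ norm_mono_le (b := 1) (x := x) (by norm_num : (0 : ℝ) < 1 / 2) hre)
      (fun x hx ↦ mono_of_not_mem (by simpa using hx)))
    unfold G
    rw [integral_sub hm1 (hm2.const_mul _), MeasureTheory.integral_const_mul,
      integral_monoPiece hre (by linarith), integral_monoPiece hre (by norm_num)]
    have hkid := kappa_identity hre η
    have hw0 : 1 - ρ ≠ 0 := one_sub_ne_zero hre
    rw [Complex.ofReal_one, Complex.one_cpow]
    field_simp
    linear_combination hkid
  rw [hGint]; simp

/-- The `L¹` norm of `F_η` is bounded uniformly: `∫ ‖F_η‖ ≤ 32`. -/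
theorem integral_norm_F_le (hre : ρ.re = 1 / 2) {η : ℝ} (hη : 0 < η) (hη1 : η ≤ 1 / 2) :
    ∫ x, ‖F ρ η x‖ ≤ 32 := by
  have hG := integrable_G hre hη hη1 (ρ := ρ)
  have hGn : ∫ x, ‖G ρ η x‖ ≤ 16 := by
    have hind : ∫ x, ‖G ρ η x‖ ≤ ∫ x, (Set.Icc η 1).indicator (fun x ↦ 8 * x ^ (-(1 / 2 : ℝ))) x := by
      refine MeasureTheory.integral_mono hG.norm ?_ (norm_G_le hre hη hη1)
      rw [integrable_indicator_iff measurableSet_Icc]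
      refine (ContinuousOn.integrableOn_Icc ?_)
      exact continuousOn_const.mul (continuousOn_id.rpow_const fun x hx ↦
        Or.inl (hη.trans_le hx.1).ne')
    refine hind.trans ?_
    rw [integral_indicator measurableSet_Icc, integral_Icc_eq_integral_Ioc,
      ← intervalIntegral.integral_of_le (by linarith : η ≤ 1), intervalIntegral.integral_const_mul,
      integral_rpow (Or.inl (by norm_num))]
    norm_num
    have : 0 ≤ η ^ (1 / 2 : ℝ) := by positivity
    nlinarith
  calc ∫ x, ‖F ρ η x‖ ≤ ∫ x, ‖G ρ η x‖ + ‖G ρ η (-x)‖ :=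
        MeasureTheory.integral_mono (integrable_F hre hη hη1).norm (hG.norm.add hG.comp_neg.norm)
          fun x ↦ norm_add_le _ _
    _ = (∫ x, ‖G ρ η x‖) + ∫ x, ‖G ρ η (-x)‖ := integral_add hG.norm hG.comp_neg.norm
    _ = (∫ x, ‖G ρ η x‖) + ∫ x, ‖G ρ η x‖ := by
        rw [integral_neg_eq_self (fun x ↦ ‖G ρ η x‖) volume]
    _ ≤ 32 := by linarith


/-! ## LEMMA 3 (the leakage diverges) and THEOREM U0 -/

variable {ρ : ℂ}

/-- **LEMMA 3.** `leakage λ F_η ≥ log((1/2)/η) - 2048 λ`: Plancherel on `L¹ ∩ L²` (tree), the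
in-band part bounded by `‖F_η‖₁² · 2λ ≤ 32² · 2λ`, and `∫ ‖F_η‖² ≥ ∫_η^{1/2} x⁻¹ dx`. -/
theorem leakage_ge (hre : ρ.re = 1 / 2) {η lam : ℝ} (hη : 0 < η) (hη1 : η ≤ 1 / 4)
    (hlam : 1 ≤ lam) :
    Real.log ((1 / 2) / η) - 2048 * lam ≤ leakage lam (F ρ η) := by
  have hη2 : η ≤ 1 / 2 := by linarith
  have hF1 := integrable_F hre hη hη2 (ρ := ρ)
  have hF2 := memLp_F hre hη hη2 (ρ := ρ)
  have hFour2 : MemLp (𝓕 (F ρ η)) 2 (volume : Measure ℝ) :=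
    Literature.Analysis.FunctionSpaces.memLp_two_fourierIntegral hF1 hF2
  have hInt : Integrable (fun ξ ↦ ‖𝓕 (F ρ η) ξ‖ ^ 2) (volume : Measure ℝ) :=
    (memLp_two_iff_integrable_sq_norm hFour2.1).1 hFour2
  have hPl : ∫ ξ, ‖𝓕 (F ρ η) ξ‖ ^ 2 = ∫ x, ‖F ρ η x‖ ^ 2 :=
    Literature.Analysis.FunctionSpaces.integral_norm_sq_fourierIntegral_eq hF1 hF2
  set S : Set ℝ := {ξ : ℝ | lam ≤ |ξ|} with hS
  have hSm : MeasurableSet S := measurableSet_le measurable_const continuous_abs.measurable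
  have hsplit := integral_add_compl (μ := volume) hSm hInt
  -- the in-band part
  have hSc : Sᶜ = Set.Ioo (-lam) lam := by
    ext ξ; simp [hS, abs_lt, and_comm]
  have hC3 : ∀ ξ, ‖𝓕 (F ρ η) ξ‖ ^ 2 ≤ 32 ^ 2 := fun ξ ↦
    pow_le_pow_left₀ (norm_nonneg _)
      ((norm_fourier_le_integral_norm _ ξ).trans (integral_norm_F_le hre hη hη2)) 2
  have hin : ∫ ξ in Sᶜ, ‖𝓕 (F ρ η) ξ‖ ^ 2 ≤ 32 ^ 2 * (2 * lam) := by
    calc ∫ ξ in Sᶜ, ‖𝓕 (F ρ η) ξ‖ ^ 2 ≤ ∫ ξ in Sᶜ, (32 : ℝ) ^ 2 :=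
          setIntegral_mono_on hInt.integrableOn (by rw [hSc]; exact integrableOn_const (by simp))
            hSm.compl fun ξ _ ↦ hC3 ξ
      _ = 32 ^ 2 * (2 * lam) := by
          rw [setIntegral_const, hSc, Real.volume_real_Ioo_of_le (by linarith), smul_eq_mul]; ring
  -- the lower bound on `∫ ‖F‖²`
  have hFsq : Integrable (fun x ↦ ‖F ρ η x‖ ^ 2) :=
    (memLp_two_iff_integrable_sq_norm hF2.1).1 hF2
  have hlow : Real.log ((1 / 2) / η) ≤ ∫ x, ‖F ρ η x‖ ^ 2 := by
    have h1 : ∫ x in Set.Ioo η (1 / 2), ‖F ρ η x‖ ^ 2 ≤ ∫ x, ‖F ρ η x‖ ^ 2 :=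
      setIntegral_le_integral hFsq (Eventually.of_forall fun x ↦ sq_nonneg _)
    have h2 : ∫ x in Set.Ioo η (1 / 2), ‖F ρ η x‖ ^ 2 = Real.log ((1 / 2) / η) := by
      rw [setIntegral_congr_fun measurableSet_Ioo (fun x hx ↦ norm_sq_F_of_mem hre hη hx),
        ← integral_Ioc_eq_integral_Ioo, ← intervalIntegral.integral_of_le hη2,
        integral_inv (by rw [Set.uIcc_of_le hη2]; exact fun h ↦ by linarith [h.1])]
    linarith
  -- assemble
  have hleak : leakage lam (F ρ η) = (∫ x, ‖F ρ η x‖ ^ 2) - ∫ ξ in Sᶜ, ‖𝓕 (F ρ η) ξ‖ ^ 2 := by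
    unfold leakage; rw [← hPl, ← hsplit]; ring
  rw [hleak]
  linarith

/-- ★ **THEOREM U0 (ATTEMPT-21): idea-1's lattice-sum uncertainty ratio (U-LATTICE) is DEGENERATE.**
For every `λ ≥ 1` and `ε > 0` there is an admissible `F` — even, `F(0) = 0`, `∫ F = 0`, supported in
`[-λ, λ]`, in `L¹ ∩ L²`, with square-integrable dilation sum on `(0, 1/λ]` — whose lattice tail is at
most `ε` times its (positive) leakage: `inf T_λ/s_λ = 0`, so no bound `ℓ·μ_min(λ) ≥ m₀ > 0`
(IDEAS-prolate §127.2 (F-iv)/(F-v), §127.4 U1) can hold on the class as typed. Witness: the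
BDBLS/Burnol vector at a Hardy zero, `F_η` with `η = e^{-L}/4`, `L = 2048λ + (6K²+8)/ε + 1`. -/
theorem latticeUncertainty_degenerate (lam : ℝ) (hlam : 1 ≤ lam) (ε : ℝ) (hε : 0 < ε) :
    ∃ Φ : ℝ → ℂ, (∀ x, Φ (-x) = Φ x) ∧ Φ 0 = 0 ∧ (∫ x, Φ x = 0) ∧
      Function.support Φ ⊆ Set.Icc (-lam) lam ∧ Integrable Φ ∧ MemLp Φ 2 ∧
      IntegrableOn (fun u ↦ ‖dilationSum lam Φ u‖ ^ 2) (Set.Ioc 0 (1 / lam)) ∧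
      0 < leakage lam Φ ∧ latticeTail lam Φ ≤ ε * leakage lam Φ := by
  obtain ⟨ρ, h0, hre, him⟩ := exists_criticalZero
  set C₁ : ℝ := 6 * K ρ ^ 2 + 8 with hC₁
  have hC₁0 : 0 < C₁ := by positivity
  set L : ℝ := 2048 * lam + C₁ / ε + 1 with hL
  have hL0 : 0 ≤ L := by positivity
  set η : ℝ := Real.exp (-L) / 4 with hηdef
  have hη : 0 < η := by positivity
  have hη4 : η ≤ 1 / 4 := by
    have : Real.exp (-L) ≤ 1 := Real.exp_le_one_iff.2 (by linarith)
    rw [hηdef]; linarith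
  have hη2 : η ≤ 1 / 2 := by linarith
  have hlog : Real.log ((1 / 2) / η) = L + Real.log 2 := by
    rw [hηdef, show (1 / 2 : ℝ) / (Real.exp (-L) / 4) = 2 * (Real.exp (-L))⁻¹ by field_simp; ring,
      ← Real.exp_neg, neg_neg, Real.log_mul (by norm_num) (Real.exp_pos _).ne', Real.log_exp]
    ring
  obtain ⟨hTint, hT⟩ := latticeTail_le h0 hre him hη hη4 hlam
  have hleak := leakage_ge hre hη hη4 hlam (ρ := ρ)
  have hlog2 : 0 < Real.log 2 := Real.log_pos (by norm_num)
  have hleak' : C₁ / ε + 1 ≤ leakage lam (F ρ η) := by rw [hlog] at hleak; linarith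
  refine ⟨F ρ η, F_even, F_zero hη, integral_F hre hη hη2, support_F hη hlam,
    integrable_F hre hη hη2, memLp_F hre hη hη2, hTint, by linarith [div_pos hC₁0 hε], ?_⟩
  calc latticeTail lam (F ρ η) ≤ C₁ := hT
    _ = ε * (C₁ / ε) := by field_simp
    _ ≤ ε * leakage lam (F ρ η) := by gcongr; linarith

/-! Axiom census (expected: `propext`, `Classical.choice`, `Quot.sound`). -/
#print axioms latticeUncertainty_degenerate

end LatticeUncertainty

end Summit.RiemannHypothesis.RiemannHypothesis.Theorems
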